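import Summits.ABC.ABC.Theses.CubicResolventAllowance
import Literature.NumberTheory.EllipticCurves.Isogeny
import Literature.NumberTheory.EllipticCurves.GaloisAction
import Literature.NumberTheory.EllipticCurves.IsogenyConductorProofs
import HarnessLib

/-!
# STUB-IDEAS `stub_realCubic` · ideator k3 · generation 13 — STABILITY OF THE PROVED RUNG AT POSITIVE GENUS

Crux stmt-ABC-22740 `CubicResolventAllowance.IndexSzpiro`, stub `stub_realCubic`, route-ABC-CubicResolventAllowance.
HOME FAMILY 3 (probe the extremes), gen 13: perturbation of the one PROVED rung (lone tower `N = M·p`, genus-0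
cofactor `M`; k3 G11 H6/H7) to POSITIVE-GENUS cofactors, and the structure of the MINIMAL lone-tower violator.

* §1 FALTINGS–HERMITE SIEVE (H1 named, H2/H3 one-cycle glue): for fixed `M` and each `m ≥ 7`, only finitely many
  `E/ℚ` of conductor `M·p` have `m ∣ n_p` (twists `X_V(m)` of genus ≥ 2, `V` from a finite list); hence for
  `p ≥ p₀(M,B)`: `n_p ≤ 6` OR a prime `ℓ > B` divides `n_p`.
* §2 THE CONGRUENCE ORGAN in elliptic currency (H4 named = Mazur + Ribet + modularity + Eichler–Shimura, irrational
  newforms of level `∣ M` excluded for `ℓ > B_irr(M)`): such an `ℓ` makes `E[ℓ] ≅ E'[ℓ]` for an elliptic curve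
  `E'` of conductor DIVIDING `M`; H5 (named, Tate curve) adds the level-raising resultant `ℓ ∣ (p+1)² − a_p(E')²`.
* §3 THE RESIDUE (H6) = Frey–Mazur for the finitely many `E'` of conductor `∣ M` (Frey 1997, CSS, §1(b) Conj. 5 at
  `K = ℚ`), vacuous when no elliptic curve has conductor dividing `M` (H7, table fact: `M = 23, 29, 31, 41, 47, 59,
  71, …`).  COMPOSITION H8: H1 ∧ H4 ∧ H6 (∧ Ogg–Saito schema) ⇒ `LocalSzpiroAt M 6` for ALL `E/ℚ` (both signs),
  ineffective in `p₀`.  New unconditional habitat ⊋ genus 0; at the first REAL obstruction `M = 37` (k3 G12) the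
  residue is Frey–Mazur for `37a`, `37b` and the certificate currency is `#E₃₇ₓ(𝔽_p)·#E₃₇ₓ^{tw}(𝔽_p)` (§4).
Verdict on the stub unchanged (`open-problem`, kernel R3 of G4); this page types the dichotomy and the residue.
Glue H2, H3, H8, H10 and the vacuity H7 ⇒ H6 are PROVED here (no `sorry`); H1, H4, H5, H6, H7, H9 are `def … : Prop` named inputs.
-/

-- single-conjunct summit: `Summit.ABC.ABC` is deliberate (CONVENTIONS §2)
set_option linter.dupNamespace false

noncomputable section

open scoped NumberField
open NumberField Polynomial WeierstrassCurve

namespace Summit.ABC.ABC.Cruxes.IndexSzpiro.StubIdeas3G13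

open Summit.ABC.ABC.Theses.CubicResolventAllowance
open Literature.NumberTheory.EllipticCurves

/-! ## §0 The stub (verbatim) and the local currencies -/

/-- The registered stub `stub_realCubic`, verbatim. -/
def StubRealCubic : Prop :=
  ∀ ε : ℝ, 0 < ε → ∃ C : ℝ, ∀ (W : WeierstrassCurve ℚ) [W.IsElliptic] (K : Type) [Field K] [NumberField K],
    Irreducible W.twoTorsionPolynomial.toPoly → Module.finrank ℚ K = 3 →
    (∃ θ : K, aeval θ W.twoTorsionPolynomial.toPoly = 0) → 0 < NumberField.discr K →
    (W.minimalDiscriminantNorm ℤ : ℝ) ≤ C * |(NumberField.discr K : ℝ)| * (W.conductorNorm ℤ : ℝ) ^ (6 + ε)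

/-- **H0 (def, = k3 G11 H0).** `LocalIndexSzpiroAt M B`: for all large primes `p ∤ M`, every REAL class curve of
conductor `N = M·p` has `n_p = v_p(Δ_min) ≤ B`. -/
def LocalIndexSzpiroAt (M B : ℕ) : Prop :=
  ∃ p₀ : ℕ, ∀ (W : WeierstrassCurve ℚ) [W.IsElliptic] (K : Type) [Field K] [NumberField K],
    Irreducible W.twoTorsionPolynomial.toPoly → Module.finrank ℚ K = 3 →
    (∃ θ : K, aeval θ W.twoTorsionPolynomial.toPoly = 0) → 0 < NumberField.discr K →
    ∀ p : ℕ, p.Prime → p₀ ≤ p → ¬ p ∣ M → W.conductorNorm ℤ = M * p →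
      (W.minimalDiscriminantNorm ℤ).factorization p ≤ B

/-- **H0′ (def).** `LocalSzpiroAt M B`: the same for ALL elliptic curves over `ℚ` (no 2-division hypothesis, no
sign) — Bennett–Yazdani 2012 Conj. 1.2 at cofactor `M` is `LocalSzpiroAt M 6`. -/
def LocalSzpiroAt (M B : ℕ) : Prop :=
  ∃ p₀ : ℕ, ∀ (W : WeierstrassCurve ℚ) [W.IsElliptic],
    ∀ p : ℕ, p.Prime → p₀ ≤ p → ¬ p ∣ M → W.conductorNorm ℤ = M * p →
      (W.minimalDiscriminantNorm ℤ).factorization p ≤ B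

/-- The class version is a specialisation of the sign-blind one (PROVED). -/
theorem localIndexSzpiroAt_of_localSzpiroAt {M B : ℕ} (h : LocalSzpiroAt M B) : LocalIndexSzpiroAt M B := by
  obtain ⟨p₀, hp₀⟩ := h
  exact ⟨p₀, fun W _ K _ _ _ _ _ _ p hp hle hnd hN => hp₀ W p hp hle hnd hN⟩

/-! ## §1 The Faltings–Hermite sieve -/

/-- **H1a (def).** `TowerDivisorFinite M m`: for all large primes `p ∤ M`, no `E/ℚ` of conductor `M·p` has
`m ∣ n_p`.  For `m ≥ 7` this is a THEOREM (ineffective): `m ∣ n_p` (`p > m`) makes `ρ_{E,m}` unramified at `p`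
(Tate curve; Frey 1997 Prop. 1.3(2)), hence unramified outside `m·M`, hence one of finitely many `(V, ε)`
(Hermite–Minkowski), so `E` is a `ℚ`-point of one of finitely many twists `X_V^{ε}(m)` of `X(m)`, of genus ≥ 3 for
`m ≥ 7` (Faltings 1983); finitely many `j`, finitely many admissible twists, finitely many `p`. -/
def TowerDivisorFinite (M m : ℕ) : Prop :=
  ∃ p₀ : ℕ, ∀ (W : WeierstrassCurve ℚ) [W.IsElliptic],
    ∀ p : ℕ, p.Prime → p₀ ≤ p → ¬ p ∣ M → W.conductorNorm ℤ = M * p →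
      ¬ m ∣ (W.minimalDiscriminantNorm ℤ).factorization p

/-- **H1 (named input; Faltings + Hermite–Minkowski + genus `X(m) ≥ 3` for `m ≥ 7`; the prime case `m = ℓ` is
route LevelLoweredSzpiro's BC5 plan-only rung «bounded Serre level ⇒ bounded Δ_min»).** -/
def FaltingsHermiteSieve (M : ℕ) : Prop :=
  ∀ m : ℕ, 7 ≤ m → TowerDivisorFinite M m

/-- **H2 (helper, S, ≤ 1 cycle; elementary).** An integer `n ≥ 7` with no divisor in `[7, 7B]` has a prime factor
`> B` (multiply prime factors of `n` until the product first reaches `7`: it is then `< 7·(largest prime used)`). -/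
theorem exists_prime_factor_gt (n B : ℕ) (h7 : 7 ≤ n)
    (h : ∀ m : ℕ, 7 ≤ m → m ≤ 7 * B → ¬ m ∣ n) : ∃ ℓ : ℕ, ℓ.Prime ∧ B < ℓ ∧ ℓ ∣ n := by
  classical
  have hex : ∃ d, 7 ≤ d ∧ d ∣ n := ⟨n, h7, dvd_rfl⟩
  obtain ⟨d, ⟨hd7, hdn⟩, hmin⟩ : ∃ d, (7 ≤ d ∧ d ∣ n) ∧ ∀ d' < d, ¬ (7 ≤ d' ∧ d' ∣ n) :=
    ⟨Nat.find hex, Nat.find_spec hex, fun d' hd' => Nat.find_min hex hd'⟩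
  have hd1 : d ≠ 1 := by omega
  have hq : d.minFac.Prime := Nat.minFac_prime hd1
  obtain ⟨e, he⟩ : d.minFac ∣ d := Nat.minFac_dvd d
  have hq2 : 2 ≤ d.minFac := hq.two_le
  have hepos : 0 < e := by
    rcases Nat.eq_zero_or_pos e with h0 | h0
    · rw [h0, mul_zero] at he; omega
    · exact h0
  have he_dvd_d : e ∣ d := Dvd.intro_left d.minFac he.symm
  have he_lt : e < d := by rw [he]; nlinarith
  have he6 : e ≤ 6 := by
    by_contra hcon
    exact hmin e he_lt ⟨by omega, he_dvd_d.trans hdn⟩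
  have hdB : 7 * B < d := by
    by_contra hcon
    exact h d hd7 (by omega) hdn
  refine ⟨d.minFac, hq, ?_, (Dvd.intro e he.symm : d.minFac ∣ d).trans hdn⟩
  have hqe : d.minFac * e ≤ d.minFac * 6 := Nat.mul_le_mul_left _ he6
  omega

/-- **H3 (helper, S/M, ≤ 1 cycle).** The sieve dichotomy: uniform `p₀` over the finite window `m ∈ [7, 7B]`
(`Finset.sup` of the `p₀(M,m)` of H1) and H2. -/
theorem sieve_dichotomy {M : ℕ} (hS : FaltingsHermiteSieve M) (B : ℕ) :
    ∃ p₀ : ℕ, ∀ (W : WeierstrassCurve ℚ) [W.IsElliptic],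
      ∀ p : ℕ, p.Prime → p₀ ≤ p → ¬ p ∣ M → W.conductorNorm ℤ = M * p →
        (W.minimalDiscriminantNorm ℤ).factorization p ≤ 6 ∨
          ∃ ℓ : ℕ, ℓ.Prime ∧ B < ℓ ∧ ℓ ∣ (W.minimalDiscriminantNorm ℤ).factorization p := by
  classical
  let f : ℕ → ℕ := fun m => if h : 7 ≤ m then Classical.choose (hS m h) else 0
  have hf : ∀ (m : ℕ) (hm : 7 ≤ m) (W : WeierstrassCurve ℚ) [W.IsElliptic] (p : ℕ), p.Prime → f m ≤ p →
      ¬ p ∣ M → W.conductorNorm ℤ = M * p → ¬ m ∣ (W.minimalDiscriminantNorm ℤ).factorization p := by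
    intro m hm W _ p hp hle
    have hspec := Classical.choose_spec (hS m hm)
    have hfm : f m = Classical.choose (hS m hm) := by simp only [f, dif_pos hm]
    exact hspec W p hp (hfm ▸ hle)
  refine ⟨(Finset.Icc 7 (7 * B)).sup f, fun W _ p hp hle hnd hN => ?_⟩
  by_cases h6 : (W.minimalDiscriminantNorm ℤ).factorization p ≤ 6
  · exact Or.inl h6
  · refine Or.inr (exists_prime_factor_gt _ B (by omega) fun m hm7 hmB => ?_)
    exact hf m hm7 W p hp ((Finset.le_sup (f := f) (Finset.mem_Icc.mpr ⟨hm7, hmB⟩)).trans hle) hnd hN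

/-! ## §2 The congruence organ, in elliptic-curve currency -/

/-- `E[ℓ] ≅ E'[ℓ]` as `Gal(ℚ̄/ℚ)`-modules (the tree's torsion-sharing shape, as in
`IsogenyGlueCongruence.PolyFreyMazurPairs`). -/
def TorsionSharing (W W' : WeierstrassCurve ℚ) (ℓ : ℕ) : Prop :=
  ∃ e : W.geomTorsion ℓ ≃+ W'.geomTorsion ℓ,
    ∀ (σ : Field.absoluteGaloisGroup ℚ) (P : W.geomTorsion ℓ), e (σ • P) = σ • e P

/-- **H4 (named input) — lone-tower torsion sharing.**  There is `B = B(M)` (`≥ max(163, M, B_irr(M))`) such that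
for primes `p ∤ M`, `ℓ > B` and `E/ℚ` of conductor `M·p` with `ℓ ∣ n_p`, some elliptic curve `E'/ℚ` of conductor
DIVIDING `M` has `E[ℓ] ≅ E'[ℓ]`.  Ingredients: `ℓ > 163` ⇒ `ρ̄_{E,ℓ}` irreducible (Mazur 1978); `ℓ ∣ n_p` ⇒ `ρ̄`
finite/unramified at `p` ⇒ `ρ̄ ≅ ρ̄_{g,λ}`, `g` a newform of weight 2 and level `∣ M` (Ribet 1990 Thm 1.1 +
modularity, tree `exists_isNewformOf`); `g` irrational ⇒ `ℓ ∣ N_{K_g/ℚ}(a − a_q(g)) ≠ 0` for some `|a| ≤ 2√q` at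
one of three fixed primes `q` with `a_q(g) ∉ ℚ` ⇒ `ℓ ≤ B_irr(M)`; `g` rational ⇒ `E' = E_g` (Eichler–Shimura,
Faltings, Carayol), `E[ℓ] ≅ E_g[ℓ]^{ss} = E_g[ℓ]`.  [Bennett–Yazdani 2012 §6; Serre 1987 §4; Kraus 1997] -/
def LoneTowerTorsionSharing (M : ℕ) : Prop :=
  ∃ B : ℕ, ∀ (W : WeierstrassCurve ℚ) [W.IsElliptic] (p ℓ : ℕ), p.Prime → ℓ.Prime → ¬ p ∣ M →
    W.conductorNorm ℤ = M * p → B < ℓ → ℓ ∣ (W.minimalDiscriminantNorm ℤ).factorization p →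
      ∃ (W' : WeierstrassCurve ℚ) (_ : W'.IsElliptic), W'.conductorNorm ℤ ∣ M ∧ TorsionSharing W W' ℓ

/-- **H5 (named input, certificate currency) — the level-raising resultant.**  In the situation of H4 with
`ℓ ≠ p`: `tr ρ̄_{E,ℓ}(Frob_p) = ±(p+1)` (Tate curve, `ρ̄` unramified at `p`) and `tr ρ̄_{E',ℓ}(Frob_p) = a_p(E')`
(`E'` good at `p ∤ M`), so `ℓ ∣ (p+1)² − a_p(E')²` — Ribet's level-RAISING condition read backwards
(Bennett–Yazdani 2012 Prop. 6.2; Diamond 1989); `a_p(E') = W'.LFunction p` (Mathlib). Nonzero by Hasse. -/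
def LevelRaisingResultant (M : ℕ) : Prop :=
  ∀ (W W' : WeierstrassCurve ℚ) [W.IsElliptic] [W'.IsElliptic] (p ℓ : ℕ), p.Prime → ℓ.Prime → ¬ p ∣ M →
    W.conductorNorm ℤ = M * p → W'.conductorNorm ℤ ∣ M → ℓ ≠ p →
    ℓ ∣ (W.minimalDiscriminantNorm ℤ).factorization p → TorsionSharing W W' ℓ →
      (ℓ : ℤ) ∣ ((p : ℤ) + 1) ^ 2 - (W'.LFunction p) ^ 2

/-! ## §3 The residue and the composition -/

/-- **H6 (THE RESIDUE; open in general) — Frey–Mazur at level `M`.**  For `ℓ > C(M)`, an elliptic curve sharing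
its `ℓ`-torsion with a curve of conductor dividing `M` is isogenous to it.  = Frey 1997 (CSS) §1(b) Conjecture 5 at
`K = ℚ` for the finitely many `E₀` of conductor `∣ M` (qualitative part); the Frey–Mazur conjecture restricted to
one partner of level `∣ M`.  VACUOUS (hence a theorem, H7) when no elliptic curve has conductor dividing `M`. -/
def FreyMazurAtLevel (M : ℕ) : Prop :=
  ∃ C : ℕ, ∀ (W W' : WeierstrassCurve ℚ) [W.IsElliptic] [W'.IsElliptic], W'.conductorNorm ℤ ∣ M →
    ∀ ℓ : ℕ, ℓ.Prime → C < ℓ → TorsionSharing W W' ℓ → W.IsIsogenous W'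

/-- **H7 (table fact, per `M`).**  No elliptic curve over `ℚ` has conductor dividing `M` — true exactly when every
weight-2 newform of level dividing `M` is irrational: `M ∈ {1,…,10, 12, 13, 16, 18, 25}` (genus 0: G11's habitat)
and the positive-genus `M = 23, 29, 31, 41, 47, 59, 71, …` (Cremona's tables). -/
def NoEllipticCurveOfConductorDvd (M : ℕ) : Prop :=
  ∀ (W : WeierstrassCurve ℚ) [W.IsElliptic], ¬ W.conductorNorm ℤ ∣ M

/-- H7 ⇒ H6 (PROVED, vacuity). -/
theorem freyMazurAtLevel_of_noCurves {M : ℕ} (h : NoEllipticCurveOfConductorDvd M) : FreyMazurAtLevel M :=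
  ⟨0, fun _ W' _ _ hW' _ _ _ _ => (h W' hW').elim⟩

/-- The Ogg–Saito comparison schema over `ℚ` (tree named fact, consumed by
`conductorNorm_eq_of_isIsogenous_of_tate`: isogenous curves have equal conductor). -/
def OggSaitoSchema : Prop :=
  ∀ (W : WeierstrassCurve ℚ) (ℓ : ℕ) [Fact ℓ.Prime], W.artinConductorExponent_tate_eq_conductorExponent_of_isElliptic ℓ

/-- **H8 (composition, S/M, ≤ 1 cycle).**  Sieve + torsion sharing + Frey–Mazur residue ⇒ local Szpiro with the
conjectured constant `6` at cofactor `M`, for ALL `E/ℚ`.  Proof: `B := max(B_H4, C_H6)`, `p₀` from H3; if `n_p ≥ 7`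
a prime `ℓ > B` divides `n_p` (H3), H4 gives `E'` of conductor `∣ M` with `E[ℓ] ≅ E'[ℓ]`, H6 makes `E ~ E'`, so
`N_E = N_{E'} ∣ M` (Ogg–Saito), contradicting `N_E = M·p`. -/
theorem localSzpiroAt_six {M : ℕ} (hM : 0 < M) (hS : FaltingsHermiteSieve M) (hLT : LoneTowerTorsionSharing M)
    (hFM : FreyMazurAtLevel M) (hOS : OggSaitoSchema) : LocalSzpiroAt M 6 := by
  obtain ⟨B₁, hB₁⟩ := hLT
  obtain ⟨C, hC⟩ := hFM
  obtain ⟨p₀, hp₀⟩ := sieve_dichotomy hS (max B₁ C)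
  refine ⟨p₀, fun W _ p hp hle hnd hN => ?_⟩
  rcases hp₀ W p hp hle hnd hN with h6 | ⟨ℓ, hℓ, hBℓ, hdvd⟩
  · exact h6
  · exfalso
    obtain ⟨W', hW', hW'N, hsh⟩ := hB₁ W p ℓ hp hℓ hnd hN ((le_max_left _ _).trans_lt hBℓ) hdvd
    haveI : W'.IsElliptic := hW'
    have hiso : W.IsIsogenous W' := hC W W' hW'N ℓ hℓ ((le_max_right _ _).trans_lt hBℓ) hsh
    have hNN : W.conductorNorm ℤ = W'.conductorNorm ℤ := conductorNorm_eq_of_isIsogenous_of_tate hOS W W' hiso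
    have hdiv : M * p ∣ M := by rw [← hN, hNN]; exact hW'N
    have hle' : M * p ≤ M := Nat.le_of_dvd hM hdiv
    have hp2 : 2 ≤ p := hp.two_le
    nlinarith

/-- **Corollary (new unconditional-modulo-named-facts habitat, ineffective).**  At every cofactor carrying no
elliptic curve the lone-tower rung `n_p ≤ 6` holds on the real class (and for all `E/ℚ`). -/
theorem localIndexSzpiroAt_six_of_noCurves {M : ℕ} (hM : 0 < M) (hS : FaltingsHermiteSieve M)
    (hLT : LoneTowerTorsionSharing M) (hno : NoEllipticCurveOfConductorDvd M) (hOS : OggSaitoSchema) :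
    LocalIndexSzpiroAt M 6 :=
  localIndexSzpiroAt_of_localSzpiroAt (localSzpiroAt_six hM hS hLT (freyMazurAtLevel_of_noCurves hno) hOS)

/-! ## §4 The first real obstruction `M = 37`: residue and certificate currency -/

/-- `37a1 = [0,0,1,-1,0]` (rank 1) and `37b1 = [0,1,1,-23,-50]`; every elliptic curve of conductor dividing `37` is
isogenous to one of them (Cremona). -/
def W37a : WeierstrassCurve ℚ := ⟨0, 0, 1, -1, 0⟩

/-- `37b1 = [0,1,1,-23,-50]`. -/
def W37b : WeierstrassCurve ℚ := ⟨0, 1, 1, -23, -50⟩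

/-- **H9 (table fact).** The isogeny classes of conductor dividing `37` are `37a`, `37b`, and `a_p` is an isogeny
invariant (tree named fact `LFunction_eq_of_isIsogenous`). -/
def Conductor37Classes : Prop :=
  ∀ (W' : WeierstrassCurve ℚ) [W'.IsElliptic], W'.conductorNorm ℤ ∣ 37 →
    (∀ p : ℕ, p.Prime → p ≠ 37 → W'.LFunction p = W37a.LFunction p) ∨
    (∀ p : ℕ, p.Prime → p ≠ 37 → W'.LFunction p = W37b.LFunction p)

/-- **H10 (certificate at `M = 37`, S, ≤ 1 cycle from H4 + H5 + H9).**  A deep lone tower at `N = 37·p` sits at a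
LEVEL-RAISING prime of `37a` or `37b`: every prime `ℓ > B(37)`, `ℓ ≠ p`, dividing `n_p` divides
`((p+1)² − a_p(37a)²)·((p+1)² − a_p(37b)²) = #E₃₇ₐ(𝔽_p)·#E₃₇ₐ^{tw}(𝔽_p)·#E₃₇b(𝔽_p)·#E₃₇b^{tw}(𝔽_p)`. -/
theorem levelRaisingCertificate37 (hLT : LoneTowerTorsionSharing 37) (hLR : LevelRaisingResultant 37)
    (h37 : Conductor37Classes) :
    ∃ B : ℕ, ∀ (W : WeierstrassCurve ℚ) [W.IsElliptic] (p ℓ : ℕ), p.Prime → ℓ.Prime → ¬ p ∣ 37 →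
      W.conductorNorm ℤ = 37 * p → B < ℓ → ℓ ≠ p → ℓ ∣ (W.minimalDiscriminantNorm ℤ).factorization p →
        (ℓ : ℤ) ∣ (((p : ℤ) + 1) ^ 2 - (W37a.LFunction p) ^ 2) * (((p : ℤ) + 1) ^ 2 - (W37b.LFunction p) ^ 2) := by
  obtain ⟨B, hB⟩ := hLT
  refine ⟨B, fun W _ p ℓ hp hℓ hnd hN hBℓ hℓp hdvd => ?_⟩
  obtain ⟨W', hW', hW'N, hsh⟩ := hB W p ℓ hp hℓ hnd hN hBℓ hdvd
  haveI : W'.IsElliptic := hW'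
  have hp37 : p ≠ 37 := fun h => hnd (by rw [h])
  have key := hLR W W' p ℓ hp hℓ hnd hN hW'N hℓp hdvd hsh
  rcases h37 W' hW'N with ha | hb
  · rw [ha p hp hp37] at key; exact dvd_mul_of_dvd_left key _
  · rw [hb p hp hp37] at key; exact dvd_mul_of_dvd_right key _

end Summit.ABC.ABC.Cruxes.IndexSzpiro.StubIdeas3G13

end
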